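import Summits.BirchSwinnertonDyer.BirchSwinnertonDyer.Theorems.SchneiderFreeAdditiveX3AnticycControlAdditiveStubBaseCountTorsOfFacts
import Summits.BirchSwinnertonDyer.BirchSwinnertonDyer.Theorems.SchneiderFreeAdditiveX3LocalTowerTorsionFiniteX3
import Summits.BirchSwinnertonDyer.BirchSwinnertonDyer.Theorems.SchneiderFreeAdditiveX3AnticycControlAdditiveKStubLocalKernelOrder
import Literature.NumberTheory.EllipticCurves.AnticyclotomicPrimeDecompositionAboveProofs
import HarnessLib

/-!
# Crux `AnticycControlAdditiveK` (route `SchneiderFreeAdditiveX3`, item stmt-BirchSwinnertonDyer-19295):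
# the registered stub `stub_baseCountTors` (P6-add-tors, skeleton v3-K c0242a50) MODULO POITOU–TATE (i) ONLY

Seat `bsd-schneider-door-c6`, gen 5 (cell `bsd-schneider-ideate`). door-c6 gen 2 landed the registered stub
`stub_baseCountTors` VERBATIM as `stub_baseCountTors_of_facts`, conditional on THREE antecedents: Poitou–Tate
duality for Selmer structures (`poitouTate_selmerStructure_duality`), Brink's Cor. 1 above `p`
(`ZpExtension.decomp_not_le_kerSubgroup_above_of_isAnticyclotomic`) and the statement of route item 19546
(`Theses.….LocalTowerTorsionFiniteX3`, Fin_v). The last two are now TREE THEOREMS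
(`ZpExtension.decomp_not_le_kerSubgroup_above_of_isAnticyclotomic_holds`, cell bsd-schneider 2026-08-26;
`localTowerTorsionFiniteX3_proof`, door-c4 gen 6, p470355), so the stub hinges on Poitou–Tate (i) ALONE:

* **`stub_baseCountTors_of_poitouTate`** — the registered signature VERBATIM ⇐
  `∀ K, poitouTate_selmerStructure_duality K`.

What remains inside that hypothesis (prime-power level, the only level the count uses): `IsPerfect` and
`SumLocalTermEqZero` are PROVED for the pinned family `LocalInvariants.canonical`
(`poitouTate_sum_localTatePairing_eq_zero_holds`), `UnramifiedOrthogonal` is PROVED from `IsPerfect`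
(`Rank1Residual.GaloisImage.UnramifiedCup.unramifiedOrthogonal_of_isPerfect`); the one unproved conjunct is
`SelmerComplement` — Milne, *ADT* I Thm. 4.10(b), inclusion `Ker γ¹ ⊆ Im β¹`, in Howard's two-structure form
(Compositio 140 (2004) Thm. 2.1.11). CONDITIONAL (hypothesis BY NAME); no `Prop` fact minted; closes nothing
by itself; BSD is not proved by any of this.

References: [JetchevSkinnerWan2017] Prop. 3.2.1, Thm. 3.3.1 (arXiv:1512.06894 pp. 10–11); [MilneADT2006] I 4.10(b);
[Howard2004HeegnerKolyvagin] Thm. 2.1.11; [Brink2007] Cor. 1.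
-/

noncomputable section

open scoped Classical

open Field NumberField IsDedekindDomain WeierstrassCurve
open Literature.NumberTheory.EllipticCurves Literature.NumberTheory.EllipticCurves.GreenbergSelmer
open Literature.NumberTheory.GaloisRepresentations
open Literature.NumberTheory.GaloisCohomology
open Literature.NumberTheory.EllipticCurves.ModularForms
  Literature.NumberTheory.EllipticCurves.Rank1Residual
  Literature.NumberTheory.EllipticCurves.Rank1Residual.Typed
  Summit.BirchSwinnertonDyer.Rank1Residual
  Summit.BirchSwinnertonDyer.Rank1Residual.X11b
  Summit.BirchSwinnertonDyer.Rank1Residual.X11b.AcSelmer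
  Summit.BirchSwinnertonDyer.Rank1Residual.X11b.LocBridge

set_option linter.dupNamespace false

namespace Summit.BirchSwinnertonDyer.BirchSwinnertonDyer.Theorems.SchneiderFreeAdditiveX3

section StubBaseCountTorsOfPT

open Summit.BirchSwinnertonDyer.BirchSwinnertonDyer.Theses.SchneiderFreeAdditiveX3
  Summit.BirchSwinnertonDyer.BirchSwinnertonDyer.Theorems.SchneiderFree
  Summit.BirchSwinnertonDyer.BirchSwinnertonDyer.Theorems.SchneiderFreeControlAtoms

/-- Brink's Cor. 1 above `p` in the `∀ K p` hypothesis shape of `stub_baseCountTors_of_facts` (the tree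
theorem `ZpExtension.decomp_not_le_kerSubgroup_above_of_isAnticyclotomic_holds`, every number field
`K : Type` and prime `p`). [cite: Brink2007, Cor. 1 (p. 2136)] -/
theorem decomp_not_le_kerSubgroup_above_of_isAnticyclotomic_forall :
    ∀ (K : Type) [Field K] [NumberField K] (p : ℕ) [Fact p.Prime],
      ZpExtension.decomp_not_le_kerSubgroup_above_of_isAnticyclotomic K p :=
  fun K _ _ p _ => ZpExtension.decomp_not_le_kerSubgroup_above_of_isAnticyclotomic_holds K p

/-- **The registered stub `stub_baseCountTors` of crux `AnticycControlAdditiveK` (skeleton v3-K, signature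
VERBATIM as the conclusion) modulo Poitou–Tate duality for Selmer structures ONLY.** At every frame and for
the actual exponents `g`, `t` (`#ker res = p^g`, `#ker r_𝔭 = p^t`): `#Sel_𝔭(K,E[p^∞]) = p^a`,
`a = ord_p #Ш[p^∞] + 2(ord_p log_ω P − ord_p [E(K):ℤP]) + ord_p ∏_{w∣p} c_w + g − t` — door-c6 gen 2's
`stub_baseCountTors_of_facts` with its Brink-above and Fin_v antecedents discharged by the tree theorems
`ZpExtension.decomp_not_le_kerSubgroup_above_of_isAnticyclotomic_holds` and `localTowerTorsionFiniteX3_proof`.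
[cite: JetchevSkinnerWan2017, Prop. 3.2.1 and Thm. 3.3.1 (arXiv:1512.06894 pp. 10–11)]
[cite: MilneADT2006, Ch. I, Thm. 4.10(b)] [cite: Brink2007, Cor. 1] -/
theorem stub_baseCountTors_of_poitouTate
    (hPT : ∀ (K : Type) [Field K] [NumberField K], poitouTate_selmerStructure_duality K) :
    (∀ (N : ℕ) [NeZero N] (W : WeierstrassCurve ℚ) (K : Type) [Field K] [NumberField K],
        Literature.NumberTheory.EllipticCurves.kolyvagin N W K) →
      ∀ (W : WeierstrassCurve ℚ) [W.IsElliptic] [W.IsGloballyMinimal] (p : ℕ) [Fact p.Prime],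
      W.analyticRank = 1 → p ≠ 2 → ClassX3 W p → Additive.SubSemistableTwist W p →
      ∀ (N : ℕ) [NeZero N] (K : Type) [Field K] [NumberField K]
        (Dt : ModularParametrizationData W N) (H : HeegnerDatum N (NumberField.discr K)) (ι : K →+* ℂ)
        (P : (W.baseChange K).toAffine.Point),
        W.analyticRank = 1 → Additive.N10.Locus W p → W.conductorNorm ℤ = N →
        ∀ hK : IsImaginaryQuadratic K,
        Odd (NumberField.discr K) → ¬ p ∣ Units.torsionOrder K → SatisfiesHeegnerHypothesis N K →
        (W.quadraticTwist (NumberField.discr K : ℚ)).entireLFunction 1 ≠ 0 →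
        WeierstrassCurve.Affine.Point.map ι.toRatAlgHom P = heegnerPointComplex Dt H →
        ¬ IsOfFinAddOrder P →
        ∀ (κ : ZpExtension K p), κ.IsAnticyclotomic →
          ∀ (γ : Field.absoluteGaloisGroup K) [Fact (κ.IsTopGenerator γ)]
            (𝔭 : HeightOneSpectrum (𝓞 K)) (h𝔭 : ((p : ℕ) : 𝓞 K) ∈ 𝔭.asIdeal)
            (he : 𝔭.asIdeal.ramificationIdx (𝓞 ℚ) = 1) (hf : 𝔭.asIdeal.inertiaDeg (𝓞 ℚ) = 1),
            ∀ g t : ℕ, Nat.card ((W.baseChange K).resOfLe p (le_top : κ.kerSubgroup ≤ ⊤)).ker = p ^ g →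
            Nat.card (localKer κ.kerSubgroup ((W.baseChange K).geomPrimaryTorsion p) 𝔭) = p ^ t →
            ∃ a : ℕ, ((∃ _ : Finite (selmerAcBase (W.baseChange K) p 𝔭 ∅),
                  Nat.card (selmerAcBase (W.baseChange K) p 𝔭 ∅) = p ^ a) ∧
                (a : ℤ) = (padicValNat p
                    (Nat.card (AddCommGroup.primaryComponent (W.baseChange K).sha p)) : ℤ) +
                  2 * (X11b.padicLogOrd W p (embAt K p 𝔭 h𝔭 he hf) P -
                    (padicValNat p (AddSubgroup.zmultiples P).index : ℤ)) +
                    padicValNat p (X11b.tamagawaProductAbove W K p) + g - t) :=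
  stub_baseCountTors_of_facts hPT decomp_not_le_kerSubgroup_above_of_isAnticyclotomic_forall
    localTowerTorsionFiniteX3_proof

/-- **The crux decl `AnticycControlAdditiveK` (item stmt-BirchSwinnertonDyer-19295) modulo the two
Poitou–Tate facts only**: door-c6 gen 2's `anticycControlAdditiveK_of_facts_of_finV` with Brink's Thm. 2
(`decomp_not_le_kerSubgroup_of_isAnticyclotomic_forall`, door-c6 gen 4), Brink's Cor. 1 above `p` and Fin_v
discharged by name. Remaining antecedents: `poitouTate_selmerStructure_duality` (PT (i)) and
`poitouTate_sha_tateDual` (PT (ii)). CONDITIONAL; BSD is not proved by this.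
[cite: JetchevSkinnerWan2017, Thm. 3.3.1 (arXiv:1512.06894 p. 11)] [cite: MilneADT2006, Ch. I, Thm. 4.10(a),(b)] -/
theorem anticycControlAdditiveK_of_poitouTate
    (hPT : ∀ (K : Type) [Field K] [NumberField K], poitouTate_selmerStructure_duality K)
    (hPT2 : ∀ (K : Type) [Field K] [NumberField K], poitouTate_sha_tateDual K) :
    AnticycControlAdditiveK :=
  anticycControlAdditiveK_of_facts_of_finV hPT hPT2 decomp_not_le_kerSubgroup_of_isAnticyclotomic_forall
    decomp_not_le_kerSubgroup_above_of_isAnticyclotomic_forall localTowerTorsionFiniteX3_proof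

end StubBaseCountTorsOfPT

end Summit.BirchSwinnertonDyer.BirchSwinnertonDyer.Theorems.SchneiderFreeAdditiveX3

end
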